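import Summits.ResolutionOfSingularities.ResolutionOfSingularities.Theorems.FrobeniusClosingPatchingRelPerfectDepthFlagLegalGlue
import Summits.ResolutionOfSingularities.ResolutionOfSingularities.Theorems.FrobeniusClosingPatchingRelPerfectDepthFlagLegalPhasesGlue
import Summits.ResolutionOfSingularities.ResolutionOfSingularities.Theorems.FrobeniusClosingPatchingRelPerfectDepthFlagLegalPhaseTwoHolds
import Summits.ResolutionOfSingularities.ResolutionOfSingularities.Theorems.FrobeniusClosingPatchingRelPerfectDepthFlagCascade
import Summits.ResolutionOfSingularities.ResolutionOfSingularities.Theorems.FrobeniusClosingPatchingRelPerfectDepthFlagLegalOldBoundaryOfF72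
import HarnessLib

/-!
# Chain W5.2 — F6 stage 1: `LegalScopedDivisorReduction₃` BY NAME from its two OURS binders
# (the owner's closing compositions at the LSDR₃ level; T6-E1 unscoped as a corollary)

[OURS · L1 W5.2 · res-L1-w52-idea-1 (OWNER of the `LegalScopedDivisorReduction₃` design, res-L1-w52-plan-1 RULING R3 (b)/R3c).]
NOT statements of the manuscript under review (Hironaka 2017 is a CANDIDATE, never a premise); AI-written, AI review is weaker
than expert review. Def-free; every theorem is a composition BY NAME of tree theorems:

* `legalScopedDivisorReduction₃_of_binders : SingCentres₃ → DepthLegal.OldBoundaryResolution₃ → LegalScopedDivisorReduction₃`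
  — Γ `legalScopedDivisorReduction₃_of_singCentres₃_of_phaseTwo` (`…DepthFlagLegalPhasesGlue`, p535436) ∘ res-D-pv-016's
  `legalPhaseTwo₃_of_oldBoundary` (`…DepthFlagLegalPhaseTwoHolds`, p533480); phase 3 (`legalSeparation₃`, res-L1-w52-lead-1's
  separation) is fact-free inside Γ;
* `legalDivisorReduction₃_of_binders` — the UNSCOPED twin, modulo F-32bR (P `legalDivisorReduction₃_iff_scoped_of_cjsB`; the scope
  phase is res-type-049's pre-phase `stageOnePrephase₃_of_cjsB`);
* `stageOneFlag₃_of_binders` — T6-E1 `StageOneFlag₃` modulo ⟨[CoP1] Prop. 4.4 (F-33∃, a CONDITIONAL binder, never a premise of the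
  chain), F-32bR⟩ and the two binders (P `stageOneFlag₃_iff_scoped_of_cjsB` ∘ res-D-pv-054's `cascade₂_of_prop44`, p534100).

The SCOPED T6-E1b form and the R6 rung over it are res-D-pv-059 AS lead-2's record (`…DepthFlagSepRecordFinal`), not restated.
The two OURS binders are discharged from the construction fact F-72 `CossartJannsenSaito2020_canonicalSequence_history` (res-lit-6,
p533571; Cossart–Jannsen–Saito 2020 Thm. 1.4 / Cor. 6.26 with the boundary HISTORY function): (K-b) `DepthLegal.oldBoundaryResolution₃_of_F72`
IS A TREE THEOREM (res-D-pv-016 AS res-L1-w52-stub-5, `…DepthFlagLegalOldBoundaryOfF72`, p537531) and §3 below consumes it BY NAME —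
`legalPhaseTwo₃_of_F72`, `legalScopedDivisorReduction₃_of_singCentres₃_of_F72 : SingCentres₃ → F-72 → LegalScopedDivisorReduction₃`
(LSDR₃ modulo ONE OURS binder and ONE named fact); (K-conn) `singCentres₃_of_F72` (res-type-049, freeze-and-restart; R1–R4 landed
p533454 · p534034 · p535094 · p537039, (M) next) is the LAST OURS binder: when it lands, §4 (a sibling APPEND, never an in-place change) is
  `theorem legalScopedDivisorReduction₃_of_F72 (h72 : CossartJannsenSaito2020_canonicalSequence_history) :`
  `    LegalScopedDivisorReduction₃ := legalScopedDivisorReduction₃_of_singCentres₃_of_F72 (singCentres₃_of_F72 h72) h72`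
— LSDR₃ modulo F-72 alone — plus `stageOneFlag₃_of_F72 (h44) (hCJS) (h72)`.
HONEST CAVEAT (slot W5.2): the crux `PatchingRelPerfect` carries a second open problem (patching ⇒ resolution is known only in
dimension ≤ 3, `DimensionFourFrontier.zariskiPatchingUpToDim_three_iff`); this file is a rung of the LOCAL core, not of the patching.
[cite: CossartJannsenSaito2020, Thm. 1.4, Cor. 6.26, Def. 6.23] [cite: CossartPiltant2008, Prop. 4.4] [cite: Kollar2007, (3.111) Step 3]
-/

-- `Summit.<Summit>.<Sub>.Theorems` with `Sub = Summit` (single-conjunct summit, D-0017)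
set_option linter.dupNamespace false

noncomputable section

open CategoryTheory CategoryTheory.Limits AlgebraicGeometry TopologicalSpace
open Literature.AlgebraicGeometry.Resolution

namespace Summit.ResolutionOfSingularities.ResolutionOfSingularities.Theorems.DepthTargets

universe u

/-! ## §1 `LegalScopedDivisorReduction₃` from the two named OURS binders -/

/-- [OURS · L1 W5.2] **CAPSTONE (binder form): `SingCentres₃ → OldBoundaryResolution₃ → LegalScopedDivisorReduction₃`.** PROVED
(phase 1 = res-type-049's Sing-confined CJS transport behind `SingCentres₃`; phase 2 = res-D-pv-016's old-boundary transport behind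
`OldBoundaryResolution₃`; phase 3 = res-L1-w52-lead-1's `legalSeparation₃`, fact-free).
[cite: CossartJannsenSaito2020, Thm. 1.4, Cor. 6.26] [cite: Kollar2007, (3.111) Step 3] -/
theorem legalScopedDivisorReduction₃_of_binders (hF : SingCentres₃.{u}) (hOB : DepthLegal.OldBoundaryResolution₃.{u}) :
    LegalScopedDivisorReduction₃.{u} :=
  legalScopedDivisorReduction₃_of_singCentres₃_of_phaseTwo hF (legalPhaseTwo₃_of_oldBoundary hOB)

/-- [OURS · L1 W5.2] The UNSCOPED twin `LegalDivisorReduction₃` from the same two binders, modulo F-32bR (the scope phase is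
res-type-049's pre-phase). PROVED (CONDITIONAL on F-32bR). [cite: CossartJannsenSaito2020, Thm. 1.4] -/
theorem legalDivisorReduction₃_of_binders (hCJS : CossartJannsenSaito2020EmbeddedSequenceB.{u}) (hF : SingCentres₃.{u})
    (hOB : DepthLegal.OldBoundaryResolution₃.{u}) : LegalDivisorReduction₃.{u} :=
  (legalDivisorReduction₃_iff_scoped_of_cjsB hCJS).mpr (legalScopedDivisorReduction₃_of_binders hF hOB)

/-! ## §2 T6-E1 (unscoped `StageOneFlag₃`) from ⟨F-33∃, F-32bR⟩ and the two binders

The SCOPED twin `StageOneFlagScoped₃` from the same four inputs and the R6 composition over it are res-D-pv-059 AS lead-2's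
record instalment (`stageOneFlagScoped₃_of_singCentres₃_of_oldBoundary`, `oneFormMember_atomConclusion_of_singCentres₃`,
module `…DepthFlagSepRecordFinal`); they are NOT restated here. -/

/-- [OURS · L1 W5.2] **T6-E1 `StageOneFlag₃` (unscoped) modulo ⟨[CoP1] Prop. 4.4 (F-33∃), F-32bR, `SingCentres₃`,
`OldBoundaryResolution₃`⟩.** PROVED (CONDITIONAL on the F-33∃ binder `CossartPiltant2008_prop44` and on F-32bR), via P's
`stageOneFlag₃_iff_scoped_of_cjsB` and res-D-pv-054's `cascade₂_of_prop44`.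
[cite: CossartPiltant2008, Prop. 4.4] [cite: CossartJannsenSaito2020, Thm. 1.4] -/
theorem stageOneFlag₃_of_binders (h44 : CossartPiltant2008_prop44.{u})
    (hCJS : CossartJannsenSaito2020EmbeddedSequenceB.{u}) (hF : SingCentres₃.{u})
    (hOB : DepthLegal.OldBoundaryResolution₃.{u}) : StageOneFlag₃.{u} :=
  (stageOneFlag₃_iff_scoped_of_cjsB (cascade₂_of_prop44 h44) hCJS).mpr (legalScopedDivisorReduction₃_of_binders hF hOB)

/-! ## §3 The old-boundary binder discharged from F-72 (res-D-pv-016's `oldBoundaryResolution₃_of_F72`, p537531) -/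

/-- [OURS · L1 W5.2] **Phase 2 of the stage-1 flag game from F-72 alone: `LegalPhaseTwo₃` ⇐
`CossartJannsenSaito2020_canonicalSequence_history`.** PROVED (CONDITIONAL on the named fact F-72 only): res-D-pv-016's
`legalPhaseTwo₃_of_oldBoundary` (p533480) ∘ `DepthLegal.oldBoundaryResolution₃_of_F72` (p537531).
[cite: CossartJannsenSaito2020, Thm. 1.4, Cor. 6.26, Def. 6.23] -/
theorem legalPhaseTwo₃_of_F72 (h72 : CossartJannsenSaito2020_canonicalSequence_history.{u}) : LegalPhaseTwo₃.{u} :=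
  legalPhaseTwo₃_of_oldBoundary (DepthLegal.oldBoundaryResolution₃_of_F72 h72)

/-- [OURS · L1 W5.2] **`LegalScopedDivisorReduction₃` modulo ONE OURS binder (`SingCentres₃`, res-type-049's (K-conn)) and ONE named
fact (F-72).** PROVED (CONDITIONAL on F-72). [cite: CossartJannsenSaito2020, Thm. 1.4, Cor. 6.26] [cite: Kollar2007, (3.111) Step 3] -/
theorem legalScopedDivisorReduction₃_of_singCentres₃_of_F72 (hF : SingCentres₃.{u})
    (h72 : CossartJannsenSaito2020_canonicalSequence_history.{u}) : LegalScopedDivisorReduction₃.{u} :=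
  legalScopedDivisorReduction₃_of_binders hF (DepthLegal.oldBoundaryResolution₃_of_F72 h72)

/-- [OURS · L1 W5.2] T6-E1 `StageOneFlag₃` modulo ⟨[CoP1] Prop. 4.4 (F-33∃, CONDITIONAL binder), F-32bR, F-72⟩ and the ONE OURS binder
`SingCentres₃`. PROVED (CONDITIONAL on the three named facts). [cite: CossartPiltant2008, Prop. 4.4]
[cite: CossartJannsenSaito2020, Thm. 1.4, Cor. 6.26] -/
theorem stageOneFlag₃_of_singCentres₃_of_F72 (h44 : CossartPiltant2008_prop44.{u})
    (hCJS : CossartJannsenSaito2020EmbeddedSequenceB.{u}) (hF : SingCentres₃.{u})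
    (h72 : CossartJannsenSaito2020_canonicalSequence_history.{u}) : StageOneFlag₃.{u} :=
  stageOneFlag₃_of_binders h44 hCJS hF (DepthLegal.oldBoundaryResolution₃_of_F72 h72)

end Summit.ResolutionOfSingularities.ResolutionOfSingularities.Theorems.DepthTargets

end
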